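import Summits.ABC.IUTFork.Joshi.Holomorphoids
import Summits.ABC.IUTFork.Joshi.ArithTeichmullerSpace
import HarnessLib

/-!
# K. Joshi, *Construction of Arithmetic Teichmüller Spaces III* §2, II: Lemma 2.1.6 into the typed `𝔍(X,E)`, §2.3 «distinct scheme theories», §2.4 holomorphoids of elliptic curves — TYPED SIGNATURE

Sequel to `Joshi/Holomorphoids.lean` (block E of the abc-iut cell, rung LADDER-ABC:A2.E; seat abc-iut-E-t5, slot T-05;
registry rows `J3:Lem2.1.6`, `J3:Thm2.3.1`, `J3:Rmk2.3.2`, `J3:Rmk2.3.4`, `J3:Thm2.4.1`, `J3:Rmk2.4.2` of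
`plan/E/JOSHI-DAG.tsv`). FRAMING as there: an UNREFEREED preprint's objects and stated results typed as signatures;
typed ≠ proved; typed AS A CANDIDATE ≠ endorsed; NO SIDE taken on [IUTchIII] Cor. 3.12 or on any author; no abc claim.

SOURCES: [J-III] = K. Joshi, arXiv:2401.13508v4 (bib `Joshi2024ATS3`), Lemma 2.1.6 p. 22, §2.3 pp. 23–25 (Thm. 2.3.1,
Rmk. 2.3.2 with eq. (2.3.3), Rmk. 2.3.4), §2.4 pp. 25–26 (Thm. 2.4.1, Rmk. 2.4.2) (locators `p.N l.a–b` = lines of the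
cell's render page files); [J-I] = arXiv:2106.11452v4 (bib `Joshi2021ATS1`) §8 / Thm (th:main4), AS TYPED by seat E-t1
(`Joshi.Untilt`, `Joshi.ATSObj`, `Joshi.ATSObj.self`, `Joshi.GlobalATSObj`; files `ArithTeichmullerSpace` p428170,
`ArithTeichmullerLandscape`).
WHAT IS HERE. (B′) MERGE with E-t1 (merge-debt M-2 of the first file, PAID): a `FiniteChart` relates the adelic
signature `ArithFFDatum` at the finite places to E-t1's typed untilts, and Lemma 2.1.6 becomes the CONSTRUCTION
`GlobalHolomorphoid.toGlobalATS : ∀ ℘, Joshi.ATSObj (X ℘)` (= `Joshi.GlobalATSObj ι pOf X` by `rfl`) with `Y := X_℘`,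
label `:= id`, `K := K_{y_℘}` (the geometric base-point is forgotten: E-t1's objects are the [J-I] §8 triples); merge-debt
M-5: [J2h] Def. 6.2.3 / Def. 5.2.1 are typed UNBUNDLED by E-t38 (`Joshi.ATS2half.Holomorphoid Pt Morph`, `TopEquivalent`,
`KedlayaTemkinChoice`, file `ArithmeticoidCohomology`): `GlobalHolomorphoid G` ↦ `⟨H.point, H.basePoint⟩` and
`ArithFFDatum.IsTopEquivalent A = ATS2half.TopEquivalent A.Y A.K` by `rfl` (not imported here). (D) §2.3:
`(X, arith(L)_y)^sch` = a scheme LABELLED by `y` (`SchLabel`), `Sch/arith(L)_y` = Mathlib's induced category,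
Thm. 2.3.1 first sentence PROVED as the forgetful EQUIVALENCE `forgetArithEquivalence`, `Sch_L` (2.3.3) = the sigma
category fibred over the DISCRETE base, the base-point-forgetting functors; Thm. 2.3.1's second (modal) sentence is the
first file's reading predicate `ArithFFDatum.ExistTopInequivalentArithmeticoids` ([J2h] Thm. 5.5.2 (7)). (E) §2.4: curve
vocabulary as UNINTERPRETED predicates (no «strict Belyi type» [AbsTopII Def. 3.5] in tree or Mathlib; E-t6's
`InitialThetaDataJoshi` likewise does not carry §3.1 (2)), Thm. 2.4.1 (1) as a claim over them; Thm. 2.4.1 (2) as the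
SIGNATURE `LocalGaloisMonoidData` of what print says «one has» (the surjection `Π^temp_{X/L_v;K_v} ↠ G_{L_v,K_v}`, the
field `L̄_v` with `O_{L̄_v}` and its Galois action) with (b) `L̄_v^*` = Mathlib's `nonZeroDivisors`, (c) `O^*`, (d) `O^▹`
DERIVED together with the invariance of each under Galois (merge-debt M-3: E-t1's `ArithTeichmullerLandscape` has the
same monoids on the FIXED `Q̄_p`, the «copies identified» side of the cell's fork); Thm. 2.4.1 (3) as a claim (the
abstract-isomorphy clause; «quantifiably distinct» names no quantity and is not typed). NOT HERE: Hodge theaters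
(Rmk. 2.3.4 → [J-III] §10, slot T-34); Rmk. 2.4.2 (E6 attach point, locator rows only). Style rules as in the first file
(no notation / axiom / `sorry` / new instance; claims tagged `@[claim "Joshi2024ATS3" "disputed"]`, never asserted).
-/

noncomputable section
universe u u₁ v₁ u₂ v₂ w
namespace Summit.ABC.IUTFork.Joshi.ATS3
open CategoryTheory
section Analytic

variable {L : Type u} [Field L] {A : ArithFFDatum L}
variable {Sch : Type u₁} [Category.{v₁} Sch] {An : A.V → Type u₂} [∀ v, Category.{v₂} (An v)]
variable (G : AnalyticSignature A Sch An)

/-! ## B′. Lemma 2.1.6 into E-t1's typed adelic Arithmetic Teichmüller space (finite places) -/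

section Bridge

open Literature.AnabelianGeometry.SemiGraphs (TemperedCurve)

variable {ι : Type} (pOf : ι → ℕ) [∀ ℘, Fact (pOf ℘).Prime] (X : ∀ ℘ : ι, TemperedCurve (pOf ℘))

variable (A) in
/-- **Finite-place chart** from the adelic signature to E-t1's typed objects (the merge datum for Lemma 2.1.6): for
finite places `℘ : ι` of `L` with residue characteristics `pOf ℘` and OUR local curves `X ℘ = X ×_L L_℘ : TemperedCurve`
(base field `(X ℘).K = L_℘ ⊆ Q̄_{p_℘}`), the place `v(℘) ∈ V_L`, the identification of `L_℘` with the signature's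
completion `L_{v(℘)}`, and for every closed classical point `y ∈ |Y_{v(℘)}|` its residue field `K_y` AS an algebraically
closed perfectoid field in the typed sense `Joshi.Untilt (pOf ℘)` ([J2h] Prop. 4.8.3 (1); [J-I] §3 Lemma: «algebraically
closed, complete rank-one valued, residue characteristic `p` ⟺ algebraically closed perfectoid») with `L_℘ ↪ K_y`
continuous on `ℚ_p` ([J-I] §3: the embedding induces the `p`-adic topology). DATA relating two typings of the same
printed objects; nothing asserted. [claim: Joshi2024ATS3, status: disputed] -/
structure FiniteChart where
  /-- the place `v(℘) ∈ V_L` under the finite place `℘` -/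
  place : ι → A.V
  /-- OUR `L_℘ = (X ℘).K` into the signature's completion `L_{v(℘)}` -/
  toLv : ∀ ℘, (X ℘).K →+* A.Lv (place ℘)
  /-- the residue field `K_y` (`y ∈ |Y_{v(℘)}|`) as a typed untilt -/
  untilt : ∀ ℘, A.Y (place ℘) → Untilt (pOf ℘)
  /-- `K_y ≅ (untilt ℘ y).K` as fields -/
  res : ∀ ℘ (y : A.Y (place ℘)), A.K (place ℘) y ≃+* (untilt ℘ y).K
  /-- the composite `L_℘ → L_{v(℘)} ↪ K_y ≅ K` is continuous on `ℚ_p` -/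
  continuous_emb : ∀ ℘ (y : A.Y (place ℘)),
    Continuous fun x : ℚ_[pOf ℘] => res ℘ y (A.emb (place ℘) y (toLv ℘ (algebraMap ℚ_[pOf ℘] (X ℘).K x)))

namespace FiniteChart

variable {pOf X} (𝒞 : FiniteChart A pOf X)

/-- The embedding `L_℘ ↪ K_y` of the untilt at the point `y` over the finite place `℘`, read in E-t1's typing
([J2h] Def. 5.1.1 «`L_v ↪ K_v`»). [claim: Joshi2024ATS3, status: disputed] -/
def embAt (℘ : ι) (y : A.Y (𝒞.place ℘)) : (X ℘).K →+* (𝒞.untilt ℘ y).K :=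
  (𝒞.res ℘ y).toRingHom.comp ((A.emb (𝒞.place ℘) y).comp (𝒞.toLv ℘))

/-- `embAt` is continuous on `ℚ_p`. [folklore] -/
theorem continuous_embAt (℘ : ι) (y : A.Y (𝒞.place ℘)) :
    Continuous fun x : ℚ_[pOf ℘] => 𝒞.embAt ℘ y (algebraMap ℚ_[pOf ℘] (X ℘).K x) :=
  𝒞.continuous_emb ℘ y

/-- The object `(X_℘/L_℘, L_℘ ↪ K_{y_℘}, id)` of `𝔍(X_℘, L_℘)` attached to an arithmeticoid `y` at every finite place
(Lemma 2.1.6's rule on the arithmeticoid alone; E-t1's `ATSObj.self`). [claim: Joshi2024ATS3, status: disputed] -/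
def atsOf (y : A.Points) : ∀ ℘ : ι, ATSObj (X ℘) :=
  fun ℘ => ATSObj.self (X ℘) (𝒞.untilt ℘ (y (𝒞.place ℘))) (𝒞.embAt ℘ (y (𝒞.place ℘)))
    (𝒞.continuous_embAt ℘ (y (𝒞.place ℘)))

end FiniteChart

namespace GlobalHolomorphoid

variable {G pOf X} (H : GlobalHolomorphoid G) (𝒞 : FiniteChart A pOf X)

/-- **Lemma 2.1.6, into the tree's typed `J(X/L) = ∏_℘ J(X/L_℘)`** ([J-III] p.22 l.7–26; the type `∀ ℘, ATSObj (X ℘)`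
IS E-t1's `Joshi.GlobalATSObj ι pOf X` of `ArithTeichmullerLandscape`, [J-I] Thm (th:main4), by `rfl` — spelled out
here so that this file depends on `ArithTeichmullerSpace` only): the holomorphoid `(X ↪ arith(L)_y)` gives, at every finite place `℘`, the object
`(X_℘/L_℘, L_℘ ↪ K_{y_℘}, id : Π^temp(X_℘/L_℘) ≅ Π^temp(X_℘/L_℘))` of `𝔍(X_℘, L_℘)` — the printed rule with `Y := X`
(E-t1's `ATSObj.self`). The geometric base-point is forgotten (E-t1's `ATSObj` types the [J-I] §8 triples without
`∗_K`; Rmk. 2.1.4 (1): `J(X,L_v)` «is bigger than the category of holomorphoids considered here»). DERIVED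
construction over the chart. [claim: Joshi2024ATS3, status: disputed] -/
def toGlobalATS : ∀ ℘ : ι, ATSObj (X ℘) :=
  𝒞.atsOf H.point

/-- Lemma 2.1.6's rule: the curve of the `℘`-component is `X_℘` itself. [folklore] -/
theorem toGlobalATS_Y (℘ : ι) : (H.toGlobalATS 𝒞 ℘).Y = X ℘ := rfl

/-- Lemma 2.1.6's rule: the perfectoid field of the `℘`-component is the residue field `K_{y_℘}` of `y_℘`. [folklore] -/
theorem toGlobalATS_U (℘ : ι) : (H.toGlobalATS 𝒞 ℘).U = 𝒞.untilt ℘ (H.point (𝒞.place ℘)) := rfl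

/-- Lemma 2.1.6's rule: the anabelomorphism label of the `℘`-component is the identity. [folklore] -/
theorem toGlobalATS_α (℘ : ι) : (H.toGlobalATS 𝒞 ℘).α = ContinuousMulEquiv.refl _ := rfl

/-- Two holomorphoids over the same arithmeticoid have the same image in `∏_℘ 𝔍(X_℘, L_℘)`: E-t1's objects forget the
geometric base-points (Rmk. 2.1.4 (1)). [folklore] -/
theorem toGlobalATS_eq_of_point_eq {H₁ H₂ : GlobalHolomorphoid G} (h : H₁.point = H₂.point) :
    H₁.toGlobalATS 𝒞 = H₂.toGlobalATS 𝒞 :=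
  congrArg 𝒞.atsOf h

end GlobalHolomorphoid

end Bridge

/-! ## D. Schemes over an arithmeticoid and «distinct scheme theories» ([J-III] §2.3) -/

section SchemeTheories

variable (Sch)

/-- `(X, arith(L)_y)^sch` ([J-III] §2.3 p.23 l.58–p.24 l.13): «obtained by forgetting the geometric base-point datum … of
the holomorphoid `(X, arith(L)_y)` … `(X, arith(L)_y)^sch` is the scheme `X` viewed as a scheme over `L` with the
arithmetic of `L` specified by `arith(L)_y` … a scheme over the arithmeticoid `arith(L)_y`»: a scheme LABELLED by the
arithmeticoid `y`. [claim: Joshi2024ATS3, status: disputed] -/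
structure SchLabel (y : A.NormalizedArithmeticoid) where
  /-- the scheme `X/L` -/
  X : Sch

/-- `Sch/arith(L)_y` ([J-III] §2.3 p.24 l.11–13: «For a fixed `arith(L)_y`, the category, denoted `Sch/arith(L)_y`,
with objects `(X, arith(L)_y)^sch` (and natural morphisms)»): the category structure induced from `Sch/L` along the
forgetful map. [claim: Joshi2024ATS3, status: disputed] -/
abbrev SchOverArith (y : A.NormalizedArithmeticoid) :=
  InducedCategory Sch (SchLabel.X : SchLabel Sch y → Sch)

variable (y : A.NormalizedArithmeticoid)

/-- The forgetful functor `Sch/arith(L)_y ⥤ Sch/L` («by forgetting `arith(L)_y`», p.24 l.12). [folklore] -/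
@[simps!]
def forgetArith : SchOverArith Sch y ⥤ Sch :=
  inducedFunctor _

/-- Labelling a scheme over `L` by the arithmeticoid `y`: `Sch/L ⥤ Sch/arith(L)_y`. [folklore] -/
@[simps]
def labelArith : Sch ⥤ SchOverArith Sch y where
  obj X := ⟨X⟩
  map f := InducedCategory.homMk f

/-- DERIVED — **Theorem 2.3.1, first sentence** ([J-III] p.24 l.26–28): «Each member of `{Sch/arith(L)_y}_{y∈𝒴_L}` is a
category equivalent, via the forgetful functor, to the category of `Sch/L`» (also p.24 l.11–12 and l.23–24: «If one
forgets the information of the relevant arithmeticoids, then these categories are, of course, all equivalent»). The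
second sentence («given two distinct arithmeticoids … there may be no equivalence between `Sch/arith(L)_{y₁}` and
`Sch/arith(L)_{y₂}` which is compatible with the two arithmeticoids») is modal and its «compatible» is not defined in
print; its stated ground is typed as `ArithFFDatum.ExistTopInequivalentArithmeticoids`. [folklore] -/
def forgetArithEquivalence : SchOverArith Sch y ≌ Sch :=
  CategoryTheory.Equivalence.mk (forgetArith Sch y) (labelArith Sch y) (eqToIso rfl) (eqToIso rfl)

/-- The equivalence of Theorem 2.3.1 IS the forgetful functor. [folklore] -/
theorem forgetArithEquivalence_functor : (forgetArithEquivalence Sch y).functor = forgetArith Sch y := rfl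

variable {y}

variable (A) in
/-- `Sch_L` ([J-III] Rmk. 2.3.2 p.24 l.31–p.25 l.1, eq. (2.3.3)): «a category whose class of objects is
`Sch_L = {(X, arith(L)_y)^sch : (X, arith(L)_y)^sch ∈ Sch/arith(L)_y and y ∈ 𝒴_L}` with morphisms defined in the obvious
way and view this as a fibered category `Sch_L → 𝒴_L`, `(X,arith(L)_y)^sch ↦ y`. Thus the fiber over `y` is
`Sch/arith(L)_y`.» Typed as the sigma category over the DISCRETE base (p.25 l.2–6: symmetries of `𝒴_L` «move the
fibers around»; «I do not know of any general formulation of the theory of fibered categories equipped with symmetry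
actions given by their respective base categories» — so none is typed). [claim: Joshi2024ATS3, status: disputed] -/
abbrev SchL :=
  Σ y : A.NormalizedArithmeticoid, SchOverArith Sch y

variable (A) in
/-- The projection (2.3.3) `Sch_L → 𝒴_L`, `(X, arith(L)_y)^sch ↦ y`. [folklore] -/
def SchL.proj : SchL A Sch ⥤ Discrete A.NormalizedArithmeticoid :=
  Sigma.desc fun y => (Functor.const (SchOverArith Sch y)).obj (Discrete.mk y)

/-- «Thus the fiber over `y` is `Sch/arith(L)_y`» (Rmk. 2.3.2 p.25 l.1): the inclusion of the fibre. [folklore] -/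
def SchL.fibre (y : A.NormalizedArithmeticoid) : SchOverArith Sch y ⥤ SchL A Sch :=
  Sigma.incl y

/-- The fibre inclusion lands in the fibre: composed with the projection it is constant with value `y`. [folklore] -/
theorem SchL.proj_fibre_obj (y : A.NormalizedArithmeticoid) (X : SchOverArith Sch y) :
    ((SchL.proj A Sch).obj ((SchL.fibre Sch y).obj X)).as = y := rfl

variable {Sch}

/-- §2.3 p.23 l.58–p.24 l.2: `(X, arith(L)_y) ↦ (X, arith(L)_y)^sch`, «forgetting the geometric base-point datum», on one
fibre: `HolOver G y ⥤ Sch/arith(L)_y`. [folklore] -/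
def HolOver.forgetBasePoint (y : A.NormalizedArithmeticoid) : HolOver G y ⥤ SchOverArith Sch y :=
  StructuredArrow.proj _ _ ⋙ labelArith Sch y

/-- Forgetting base-points on the whole category of holomorphoids, fibrewise: `HolCat ⥤ Sch_L`. [folklore] -/
def HolCat.forgetBasePoints : HolCat G ⥤ SchL A Sch :=
  Sigma.desc fun y => HolOver.forgetBasePoint G y ⋙ SchL.fibre Sch y

/-- Forgetting base-points commutes with the two projections to the arithmeticoids. [folklore] -/
theorem HolCat.proj_forgetBasePoints_obj (P : HolCat G) :
    ((SchL.proj A Sch).obj ((HolCat.forgetBasePoints G).obj P)).as = ((HolCat.proj G).obj P).as := rfl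

end SchemeTheories

end Analytic

/-! ## E. Holomorphoids of elliptic curves ([J-III] §2.4, Thm. 2.4.1) -/

section Elliptic

variable {L : Type u} [Field L] {A : ArithFFDatum L}
variable {Sch : Type u₁} [Category.{v₁} Sch] {An : A.V → Type u₂} [∀ v, Category.{v₂} (An v)]

variable (Sch) in
/-- Curve vocabulary on `Sch/L` used by [J-III] §2.4 p.25 l.17–21 («`C` is an elliptic curve over an arithmeticoid
`arith(L)` of `L` and write `X = C − {O}` where `O ∈ C(L)` is the origin of the group law. Observe that `X/arith(L)` is an
hyperbolic curve of topological type `(g,n) = (1,1)`») and Thm. 2.4.1 (1) («strict Belyi Type»): UNINTERPRETED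
predicates (no definition of elliptic curve over a number field / hyperbolic curve / strict Belyi type [AbsTopII Def. 3.5]
exists in the tree or in Mathlib at this generality; the tree's `IsStrictlyBelyiType` is likewise a primitive of the
[AbsTopII]/[AbsTopIII] abstract models). [claim: Joshi2024ATS3, status: disputed] -/
structure CurveVocabulary where
  /-- «`C` is an elliptic curve over `L`» (with origin `O ∈ C(L)`) -/
  IsEllipticCurve : Sch → Prop
  /-- `C ↦ X = C − {O}`, the canonically punctured curve -/
  puncture : Sch → Sch
  /-- «hyperbolic curve of topological type `(g,n)`» -/
  IsHyperbolicOfType : Sch → ℕ → ℕ → Prop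
  /-- «hyperbolic curve of strict Belyi Type» -/
  IsStrictBelyiType : Sch → Prop

/-- HYPOTHESIS — [J-III] §2.4 p.25 l.19–20 with **Thm. 2.4.1 (1)** p.25 l.27: for an elliptic curve `C` and `X = C − {O}`,
«`X/arith(L)` is an hyperbolic curve of topological type `(g,n) = (1,1)`» and «`X/L` is a hyperbolic curve of strict
Belyi Type». Signature-level (the predicates are uninterpreted); never asserted. [claim: Joshi2024ATS3, status: disputed] -/
@[claim "Joshi2024ATS3" "disputed"]
def CurveVocabulary.PuncturedEllipticIsStrictBelyi (𝒱 : CurveVocabulary Sch) : Prop :=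
  ∀ C : Sch, 𝒱.IsEllipticCurve C →
    𝒱.IsHyperbolicOfType (𝒱.puncture C) 1 1 ∧ 𝒱.IsStrictBelyiType (𝒱.puncture C)

/-- **Holomorphoid of the canonically punctured elliptic curve** ([J-III] §2.4 p.25 l.17–21: «I will refer to
`C/arith(L)` (resp. `X/arith(L)`) a holomorphoid of the elliptic curve `C/L` (resp. a holomorphoid of the canonically
punctured elliptic curve `X/L`)»): a holomorphoid whose scheme is `X = C − {O}` for an elliptic curve `C`.
[claim: Joshi2024ATS3, status: disputed] -/
structure EllipticHolomorphoid (G : AnalyticSignature A Sch An) (𝒱 : CurveVocabulary Sch)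
    extends GlobalHolomorphoid G where
  /-- the elliptic curve `C/L` -/
  C : Sch
  /-- «`C` is an elliptic curve» -/
  isElliptic : 𝒱.IsEllipticCurve C
  /-- `X = C − {O}` -/
  X_eq : X = 𝒱.puncture C

variable (Ptemp Gal Lbar : Type w) [Group Ptemp] [TopologicalSpace Ptemp] [Group Gal] [TopologicalSpace Gal]
  [Field Lbar]

/-- **The local Galois–monoid data of Thm. 2.4.1 (2)** ([J-III] p.25 l.28–p.26 l.19), the objects print says «one has»
at a place `v` «using the geometric base-points of these holomorphoids to compute absolute Galois groups and various
fundamental groups»: (a) «a surjection of topological groups `Π^temp_{X/L_v;K_v} → G_{L_v,K_v}`»; the field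
`L̄_v ⊂ K_v` («the algebraic closure of `L_v ⊂ K_v`», carrier `Lbar`) with `O_{L̄_v}` and the «natural action of
Galois»; from which (b) `L̄_v^*`, (c) `O^*_{L̄_v}`, (d) `O^▹_{L̄_v} = O_{L̄_v} − {0}` with their Galois actions are DERIVED
below. The carriers `Ptemp = Π^temp_{X/L_v;K_v}`, `Gal = G_{L_v,K_v}`, `Lbar = L̄_v` are parameters (labelled isomorphs:
the label is the holomorphoid; OUR SIDE's `Literature.AnabelianGeometry.SemiGraphs.TemperedCurve` is the same surjection
with the base field inside ONE fixed algebraic closure of `ℚ_p`; merge-debt M-3 with E-t1's [J-I] §9 monoid functors).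
[claim: Joshi2024ATS3, status: disputed] -/
structure LocalGaloisMonoidData where
  /-- (a) `Π^temp_{X/L_v;K_v} → G_{L_v,K_v}`, a continuous homomorphism -/
  proj : Ptemp →ₜ* Gal
  /-- (a) «surjection» -/
  proj_surjective : Function.Surjective proj
  /-- `O_{L̄_v} ⊂ L̄_v` -/
  O : ValuationSubring Lbar
  /-- the «natural action of Galois» of `G_{L_v,K_v}` on `L̄_v` by field automorphisms -/
  act : Gal →* RingAut Lbar
  /-- the Galois action preserves `O_{L̄_v}` -/
  act_mem_O : ∀ (g : Gal) (x : Lbar), x ∈ O → act g x ∈ O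

namespace LocalGaloisMonoidData

variable {Ptemp Gal Lbar} (D : LocalGaloisMonoidData Ptemp Gal Lbar)

/-! (b) «the monoid of non-zero elements of `L̄_v`», `L̄_v^*` ([J-III] Thm. 2.4.1 (2)(b) p.25 l.33–41) is Mathlib's
`nonZeroDivisors L̄_v` (membership `mem_nonZeroDivisors_iff_ne_zero`); it depends on the field `L̄_v` only. -/

/-- DERIVED (d): «the monoid `O^▹_{L̄_v} = O_{L̄_v} − {0}` of non-zero elements of `O_{L̄_v}`» ([J-III] Thm. 2.4.1 (2)(d)
p.26 l.11–19). [folklore] -/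
def OTri : Submonoid Lbar where
  carrier := {x | x ∈ D.O ∧ x ≠ 0}
  mul_mem' := fun {_ _} ha hb => ⟨mul_mem ha.1 hb.1, mul_ne_zero ha.2 hb.2⟩
  one_mem' := ⟨one_mem D.O, one_ne_zero⟩

/-- Membership in `O^▹_{L̄_v}`. [folklore] -/
theorem mem_OTri {x : Lbar} : x ∈ D.OTri ↔ x ∈ D.O ∧ x ≠ 0 := Iff.rfl

/-- DERIVED (c): «the monoid of units `O^*_{L̄_v}` of `O_{L̄_v}`» ([J-III] Thm. 2.4.1 (2)(c) p.26 l.1–9): the elements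
of `O_{L̄_v}` with an inverse in `O_{L̄_v}`. [folklore] -/
def unitsO : Submonoid Lbar where
  carrier := {x | x ∈ D.O ∧ ∃ x' ∈ D.O, x * x' = 1}
  mul_mem' := by
    rintro a b ⟨ha, a', ha', haa'⟩ ⟨hb, b', hb', hbb'⟩
    refine ⟨mul_mem ha hb, b' * a', mul_mem hb' ha', ?_⟩
    calc a * b * (b' * a') = a * (b * b') * a' := by ring
      _ = 1 := by rw [hbb', mul_one, haa']
  one_mem' := ⟨one_mem D.O, 1, one_mem D.O, mul_one 1⟩

/-- Membership in `O^*_{L̄_v}`. [folklore] -/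
theorem mem_unitsO {x : Lbar} : x ∈ D.unitsO ↔ x ∈ D.O ∧ ∃ x' ∈ D.O, x * x' = 1 := Iff.rfl

/-- `O^*_{L̄_v} ⊆ O^▹_{L̄_v}`. [folklore] -/
theorem unitsO_le_OTri : D.unitsO ≤ D.OTri := by
  rintro x ⟨hx, x', -, hxx'⟩
  exact ⟨hx, left_ne_zero_of_mul_eq_one hxx'⟩

/-- `O^▹_{L̄_v} ⊆ L̄_v^*`. [folklore] -/
theorem OTri_le_nonZeroDivisors : D.OTri ≤ nonZeroDivisors Lbar :=
  fun _ hx => mem_nonZeroDivisors_iff_ne_zero.2 hx.2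

/-- DERIVED: the Galois action preserves `L̄_v^*` (Thm. 2.4.1 (2)(b): `G_{L_v,K_v} ↷ L̄_v^*`). [folklore] -/
theorem act_mem_nonZeroDivisors (g : Gal) {x : Lbar} (hx : x ∈ nonZeroDivisors Lbar) :
    D.act g x ∈ nonZeroDivisors Lbar :=
  mem_nonZeroDivisors_iff_ne_zero.2 ((D.act g).map_ne_zero_iff.2 (mem_nonZeroDivisors_iff_ne_zero.1 hx))

/-- DERIVED: the Galois action preserves `O^▹_{L̄_v}` (Thm. 2.4.1 (2)(d): `G_{L_v,K_v} ↷ O^▹_{L̄_v}`). [folklore] -/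
theorem act_mem_OTri (g : Gal) {x : Lbar} (hx : x ∈ D.OTri) : D.act g x ∈ D.OTri :=
  ⟨D.act_mem_O g x hx.1, (D.act g).map_ne_zero_iff.2 hx.2⟩

/-- DERIVED: the Galois action preserves `O^*_{L̄_v}` (Thm. 2.4.1 (2)(c): `G_{L_v,K_v} ↷ O^*_{L̄_v}`). [folklore] -/
theorem act_mem_unitsO (g : Gal) {x : Lbar} (hx : x ∈ D.unitsO) : D.act g x ∈ D.unitsO := by
  obtain ⟨hx, x', hx', hxx'⟩ := hx
  refine ⟨D.act_mem_O g x hx, D.act g x', D.act_mem_O g x' hx', ?_⟩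
  rw [← map_mul, hxx', map_one]

/-- DERIVED: `Π^temp_{X/L_v;K_v}` acts on `L̄_v` (hence on the three monoids) THROUGH the surjection to `G_{L_v,K_v}`
(Thm. 2.4.1 (2)(b)–(d): «`Π^temp_{X/L_v,K_v} → G_{L_v,K_v} ↷ …`»). [folklore] -/
def piAct : Ptemp →* RingAut Lbar := D.act.comp D.proj.toMonoidHom

/-- The action of `Π^temp` factors through `G`. [folklore] -/
theorem piAct_apply (g : Ptemp) : D.piAct g = D.act (D.proj g) := rfl

end LocalGaloisMonoidData

/-- «Abstractly isomorphic» local Galois–monoid data ([J-III] Thm. 2.4.1 (3)): OUR READING at the level of the objects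
listed in (2) — the topological groups are isomorphic and the fields are isomorphic by an isomorphism carrying `O` onto
`O` (print does not specify the isomorphisms; no compatibility with the labels is asked).
[claim: Joshi2024ATS3, status: disputed] -/
def LocalGaloisMonoidData.IsAbstractlyIso {P₁ G₁ F₁ P₂ G₂ F₂ : Type w}
    [Group P₁] [TopologicalSpace P₁] [Group G₁] [TopologicalSpace G₁] [Field F₁]
    [Group P₂] [TopologicalSpace P₂] [Group G₂] [TopologicalSpace G₂] [Field F₂]
    (D₁ : LocalGaloisMonoidData P₁ G₁ F₁) (D₂ : LocalGaloisMonoidData P₂ G₂ F₂) : Prop :=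
  Nonempty (P₁ ≃ₜ* P₂) ∧ Nonempty (G₁ ≃ₜ* G₂) ∧
    ∃ e : F₁ ≃+* F₂, e '' (D₁.O : Set F₁) = (D₂.O : Set F₂)

variable {Ptemp Gal Lbar}
variable (G : AnalyticSignature A Sch An) (𝒱 : CurveVocabulary Sch)
variable (PtempOf GalOf LbarOf : EllipticHolomorphoid G 𝒱 → A.V → Type w)
  [∀ H v, Group (PtempOf H v)] [∀ H v, TopologicalSpace (PtempOf H v)]
  [∀ H v, Group (GalOf H v)] [∀ H v, TopologicalSpace (GalOf H v)] [∀ H v, Field (LbarOf H v)]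

/-- **Mochizuki's anabelian landscape attached to holomorphoids** — the assignment behind [J-III] Thm. 2.4.1 (2) p.25
l.24–p.26 l.19: «Let `hol(C/L)_y` and `hol(X/L)_y` be (pointed) holomorphoids … Then one has (using the geometric
base-points of these holomorphoids …): (2) for each `v ∈ V_L` (a) … (d)»: to every holomorphoid `H` of `X = C − {O}` and
every place `v`, local Galois–monoid data on carriers `Π^temp_{X/L_v;K_v} = PtempOf H v`, `G_{L_v,K_v} = GalOf H v`,
`L̄_v = LbarOf H v` labelled by `(H, v)`. SIGNATURE of what print says one HAS (the construction from tempered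
fundamental groups is [J-I] §§3–9, E-t1; merge-debt M-3); nothing asserted. [claim: Joshi2024ATS3, status: disputed] -/
structure AnabelianLandscape where
  /-- Thm. 2.4.1 (2): the local data at `(H, v)` -/
  data : ∀ (H : EllipticHolomorphoid G 𝒱) (v : A.V), LocalGaloisMonoidData (PtempOf H v) (GalOf H v) (LbarOf H v)

/-- HYPOTHESIS — **Thm. 2.4.1 (3)** ([J-III] p.26 l.20–23): «If `X/arith(L)_{y₁}` and `X/arith(L)_{y₂}` are two distinct
holomorphoids of `X/L` then the objects provided by (1)–(2) corresponding to `X/arith(L)_{y₁}` and `X/arith(L)_{y₂}` are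
all abstractly isomorphic but are equipped with distinct arithmetic labels and their arithmetic and geometric properties
are quantifiably distinct from each other» (proof p.26 l.24: «an elementary consequence of the results of [Joshi, 2021a,
2022, 2023a]»). TYPED: the abstract-isomorphy clause, for holomorphoids with the same scheme `X`; «distinct arithmetic
labels» is the tautology `H₁ ≠ H₂`; «quantifiably distinct» names no quantity at this point of print and is NOT typed.
Never asserted. [claim: Joshi2024ATS3, status: disputed] -/
@[claim "Joshi2024ATS3" "disputed"]
def AnabelianLandscape.AbstractlyIsomorphic (ℒ : AnabelianLandscape G 𝒱 PtempOf GalOf LbarOf) : Prop :=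
  ∀ H₁ H₂ : EllipticHolomorphoid G 𝒱, H₁.X = H₂.X →
    ∀ v : A.V, (ℒ.data H₁ v).IsAbstractlyIso (ℒ.data H₂ v)

end Elliptic
end Summit.ABC.IUTFork.Joshi.ATS3
end
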